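import Mathlib
import Summits.KontsevichZagierPeriods.KontsevichZagierPeriods.Theorems.InverseLandauTateFamilyKernelOpenCube
import Summits.KontsevichZagierPeriods.KontsevichZagierPeriods.Theorems.InverseLandauTateFamilyKernelRationalCertificate
import Summits.KontsevichZagierPeriods.KontsevichZagierPeriods.Theorems.InverseLandauTateFamilyKernelStubGlueProduct
import Summits.KontsevichZagierPeriods.KontsevichZagierPeriods.Theorems.InverseLandauTateFamilyKernelGapInstance
import Summits.KontsevichZagierPeriods.KontsevichZagierPeriods.Theorems.InverseLandauDlogLoopRelator

/-!
# `TateFamilyKernel` — a loop ⊗ cofactor vanishing element certified by kind (e) (line `Sketch`, stub `stub_productInstance`)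

Crux `TateFamilyKernel` (stmt-KontsevichZagierPeriods-9130, route `InverseLandau`), line `Sketch`, kind (e) of the
descent normal form (`Cruxes/TateFamilyKernel/Lines/Sketch.md`). The Tate family
`F = −2ϖ(1 − 2z₁ + ϖz₁²) / ((1 − ϖz₁)(1 − ϖz₁²)(2 − ϖz₂))` is the PRODUCT of the closed one-variable loop
`(φ′/φ)(z₁)`, `φ = (1 − ϖz₁)/(1 − ϖz₁²)`, `φ(0) = φ(1) = 1`, with the cofactor `2/(2 − ϖz₂)`; its open-square
integrals vanish identically and `F dz₁dz₂` is NOT Griffiths-exact (the lead's exact test, `k ≤ 3`; its de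
Rham class is the cup product of two non-zero classes). Kind (e) settles it with three landed pieces: the
loop is a one-dimensional relation (`DlogLoopRelator_proof`, item 9135), the open-interval/closed-cube bridge
(`of_sub_of_mem_relations_of_domain_eq_cube`, p104329), and the product glue `stub_glueProduct` (p115064:
Fubini product of representations + the right-ideal property of `KZ.relations`).
[cite: KontsevichZagier2001, §1.2]
-/

noncomputable section

open MeasureTheory Set MvPolynomial
open Literature.NumberTheory.Transcendental
open Literature.ModelTheory.ExponentialFields (IsSemialgebraic)

namespace Summit.KontsevichZagierPeriods.InverseLandau.TateFamilyKernel.Descent.Prod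

/-! ### Evaluations (one-variable slices live in `Fin (1 + 1)`, the family in `Fin (2 + 1)`) -/

/-- [folklore] -/
theorem snoc2_0 (y : Fin 1 → ℝ) (t : ℝ) : (Fin.snoc y t : Fin (1 + 1) → ℝ) 0 = y 0 := rfl
/-- [folklore] -/
theorem snoc2_1 (y : Fin 1 → ℝ) (t : ℝ) : (Fin.snoc y t : Fin (1 + 1) → ℝ) 1 = t := rfl

/-- Loop numerator `−ϖ(1 − 2x + ϖx²)`. [folklore] -/
theorem evalPf (v : Fin (1 + 1) → ℝ) :
    aeval v ((-(X 1 * (1 - C 2 * X 0 + X 1 * X 0 ^ 2))) : MvPolynomial (Fin (1 + 1)) ℚ) =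
      -(v 1 * (1 - 2 * v 0 + v 1 * v 0 ^ 2)) := by
  simp

/-- Loop denominator `(1 − ϖx)(1 − ϖx²)`. [folklore] -/
theorem evalQf (v : Fin (1 + 1) → ℝ) :
    aeval v (((1 - X 1 * X 0) * (1 - X 1 * X 0 ^ 2)) : MvPolynomial (Fin (1 + 1)) ℚ) =
      (1 - v 1 * v 0) * (1 - v 1 * v 0 ^ 2) := by
  simp

/-- Cofactor numerator `2`. [folklore] -/
theorem evalPg (v : Fin (1 + 1) → ℝ) : aeval v ((C 2) : MvPolynomial (Fin (1 + 1)) ℚ) = 2 := by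
  simp

/-- Cofactor denominator `2 − ϖy`. [folklore] -/
theorem evalQg (v : Fin (1 + 1) → ℝ) :
    aeval v ((C 2 - X 1 * X 0) : MvPolynomial (Fin (1 + 1)) ℚ) = 2 - v 1 * v 0 := by
  simp

/-- Family numerator. [folklore] -/
theorem evalP (v : Fin (2 + 1) → ℝ) :
    aeval v ((-(C 2 * X 2 * (1 - C 2 * X 0 + X 2 * X 0 ^ 2))) : MvPolynomial (Fin (2 + 1)) ℚ) =
      -(2 * v 2 * (1 - 2 * v 0 + v 2 * v 0 ^ 2)) := by
  simp

/-- Family denominator. [folklore] -/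
theorem evalQ (v : Fin (2 + 1) → ℝ) :
    aeval v (((1 - X 2 * X 0) * (1 - X 2 * X 0 ^ 2) * (C 2 - X 2 * X 1)) : MvPolynomial (Fin (2 + 1)) ℚ) =
      (1 - v 2 * v 0) * (1 - v 2 * v 0 ^ 2) * (2 - v 2 * v 1) := by
  simp

/-- `[0,1]¹` is `{x | x 0 ∈ [0,1]}`. [folklore] -/
theorem cube_one_eq : KZ.cube 1 = {x : Fin 1 → ℝ | x 0 ∈ Icc (0 : ℝ) 1} := by
  ext x
  simp only [KZ.mem_cube, mem_setOf_eq, mem_Icc, Fin.forall_fin_one]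

/-- `{x | x 0 ∈ (0,1)} = ∏ (0,1)` in `ℝ¹`. [folklore] -/
theorem setOf_Ioo_eq_pi : {x : Fin 1 → ℝ | x 0 ∈ Ioo (0 : ℝ) 1} = Set.pi Set.univ fun _ : Fin 1 => Ioo (0 : ℝ) 1 := by
  ext x
  simp only [mem_setOf_eq, mem_pi, mem_univ, true_implies, Fin.forall_fin_one]

/-! ### The loop is a one-dimensional relation -/

/-- The one-variable loop: every tame cube representation of `(φ′/φ)` on `[0,1]`, `φ = (1−ϖx)/(1−ϖx²)`,
`0 < ϖ < 1`, is a relation (`DlogLoopRelator_proof` on the open interval + the closed/open bridge).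
[cite: KontsevichZagier2001, §1.2] -/
theorem loop_tame_mem_relations {ϖ₀ : ℝ} (halg : IsAlgebraic ℚ ϖ₀) (h0 : 0 < ϖ₀) (h1 : ϖ₀ < 1)
    (U : KZ.IntegralRep 1) (hU : U.IsTameCube)
    (hUi : ∀ y ∈ KZ.cube 1, U.integrand y =
      aeval (Fin.snoc y ϖ₀ : Fin (1 + 1) → ℝ) ((-(X 1 * (1 - C 2 * X 0 + X 1 * X 0 ^ 2))) : MvPolynomial (Fin (1 + 1)) ℚ) /
        aeval (Fin.snoc y ϖ₀ : Fin (1 + 1) → ℝ) (((1 - X 1 * X 0) * (1 - X 1 * X 0 ^ 2)) : MvPolynomial (Fin (1 + 1)) ℚ)) :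
    KZ.of U ∈ KZ.relations := by
  -- the loop function and its derivative
  set phi : ℝ → ℝ := fun t => (1 - ϖ₀ * t) / (1 - ϖ₀ * t ^ 2) with hphi
  set dphi : ℝ → ℝ := fun t =>
    ((-ϖ₀) * (1 - ϖ₀ * t ^ 2) - (1 - ϖ₀ * t) * (-(ϖ₀ * (2 * t)))) / (1 - ϖ₀ * t ^ 2) ^ 2 with hdphi
  have hden1 : ∀ t ∈ Icc (0 : ℝ) 1, 0 < 1 - ϖ₀ * t := fun t ht => by nlinarith [ht.1, ht.2]
  have hden2 : ∀ t ∈ Icc (0 : ℝ) 1, 0 < 1 - ϖ₀ * t ^ 2 := fun t ht => by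
    nlinarith [ht.1, ht.2, mul_le_one₀ ht.2 ht.1 ht.2]
  -- the honest open-interval restriction
  have hEeq : {x : Fin 1 → ℝ | x 0 ∈ Ioo (0 : ℝ) 1} = openUnitCube 1 := by
    rw [setOf_Ioo_eq_pi]; exact pi_univ_Ioo_eq_openUnitCube 1
  have hE : IsSemialgebraic ℚ {x : Fin 1 → ℝ | x 0 ∈ Ioo (0 : ℝ) 1} := by
    rw [hEeq]; exact isSemialgebraic_openUnitCube
  have hEsub : {x : Fin 1 → ℝ | x 0 ∈ Ioo (0 : ℝ) 1} ⊆ U.domain := by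
    rw [hEeq, hU.domain_eq]; exact KZ.openUnitCube_subset_cube
  set r : KZ.IntegralRep 1 := U.restrict _ hE hEsub with hr
  have hrdom : r.domain = {x : Fin 1 → ℝ | x 0 ∈ Ioo (0 : ℝ) 1} := rfl
  -- `DlogLoopRelator` hypotheses
  have hsa : IsSemialgebraicFunOn ℚ {x : Fin 1 → ℝ | x 0 ∈ Icc (0 : ℝ) 1} (fun x => phi (x 0)) := by
    have hB : ∀ y ∈ KZ.cube 1, aeval (Fin.snoc y ϖ₀ : Fin (1 + 1) → ℝ)
        ((1 - X 1 * X 0 ^ 2) : MvPolynomial (Fin (1 + 1)) ℚ) ≠ 0 := by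
      intro y hy
      have : aeval (Fin.snoc y ϖ₀ : Fin (1 + 1) → ℝ) ((1 - X 1 * X 0 ^ 2) : MvPolynomial (Fin (1 + 1)) ℚ) =
          1 - ϖ₀ * y 0 ^ 2 := by simp [snoc2_1]
      rw [this]
      exact (hden2 (y 0) (by rw [cube_one_eq] at hy; exact hy)).ne'
    have hs := isSemialgebraicFunOn_slice ((1 - X 1 * X 0) : MvPolynomial (Fin (1 + 1)) ℚ)
      ((1 - X 1 * X 0 ^ 2) : MvPolynomial (Fin (1 + 1)) ℚ) halg hB
    have hfun : (fun w : Fin 1 → ℝ => aeval (Fin.snoc w ϖ₀ : Fin (1 + 1) → ℝ) ((1 - X 1 * X 0) : MvPolynomial (Fin (1 + 1)) ℚ) /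
        aeval (Fin.snoc w ϖ₀ : Fin (1 + 1) → ℝ) ((1 - X 1 * X 0 ^ 2) : MvPolynomial (Fin (1 + 1)) ℚ)) =
        fun x => phi (x 0) := by
      funext x
      simp [hphi, snoc2_1]
    rw [hfun, cube_one_eq] at hs
    exact hs
  have hcont : ContinuousOn phi (Icc 0 1) := by
    refine ContinuousOn.div (by fun_prop) (by fun_prop) fun t ht => (hden2 t ht).ne'
  have hpos : ∀ t ∈ Icc (0 : ℝ) 1, 0 < phi t := fun t ht => div_pos (hden1 t ht) (hden2 t ht)
  have hder : ∀ t ∈ Ioo (0 : ℝ) 1, HasDerivAt phi (dphi t) t := by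
    intro t ht
    have hf : HasDerivAt (fun y : ℝ => 1 - ϖ₀ * y) (-ϖ₀) t := by
      simpa using ((hasDerivAt_id t).const_mul ϖ₀).const_sub 1
    have hg : HasDerivAt (fun y : ℝ => 1 - ϖ₀ * y ^ 2) (-(ϖ₀ * (2 * t))) t := by
      simpa using ((hasDerivAt_pow 2 t).const_mul ϖ₀).const_sub 1
    exact hf.div hg (hden2 t (Ioo_subset_Icc_self ht)).ne'
  have hloop : phi 0 = phi 1 := by
    have h1' : (1 : ℝ) - ϖ₀ ≠ 0 := by linarith
    simp only [hphi]
    norm_num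
    rw [div_self h1']
  have hint : EqOn r.integrand (fun x => dphi (x 0) / phi (x 0)) r.domain := by
    intro x hx
    have hx' : x 0 ∈ Ioo (0 : ℝ) 1 := by rw [hrdom] at hx; exact hx
    have hxc : x ∈ KZ.cube 1 := by rw [cube_one_eq]; exact Ioo_subset_Icc_self hx'
    have hq1 := (hden1 (x 0) (Ioo_subset_Icc_self hx')).ne'
    have hq2 := (hden2 (x 0) (Ioo_subset_Icc_self hx')).ne'
    show U.integrand x = dphi (x 0) / phi (x 0)
    rw [hUi x hxc, evalPf, evalQf, snoc2_0, snoc2_1]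
    simp only [hphi, hdphi]
    field_simp
    ring
  have hrrel : KZ.of r ∈ KZ.relations :=
    DlogLoopRelator_proof phi dphi r hsa hcont hpos hder hloop hrdom hint
  -- bridge back to the closed cube
  have hsub : KZ.of U - KZ.of r ∈ KZ.relations :=
    of_sub_of_mem_relations_of_domain_eq_cube U r hU.domain_eq (by rw [hrdom, setOf_Ioo_eq_pi]) fun x _ => by
      simp [hr]
  have : KZ.of U = (KZ.of U - KZ.of r) + KZ.of r := by abel
  rw [this]
  exact KZ.relations.add_mem hsub hrrel

end Prod

open Prod in
/-- STUB `stub_productInstance` of line `Sketch` — **a loop ⊗ cofactor vanishing element certified by kind (e).**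
For real-algebraic `ϖ₀ ∈ (0,1)` (the admissible range), every tame cube representation on `[0,1]²` of the fibre
of `F = −2ϖ(1 − 2z₁ + ϖz₁²)/((1 − ϖz₁)(1 − ϖz₁²)(2 − ϖz₂))` lies in `KZ.relations`: the factor in `z₁` is the
loop `φ′/φ` (a relation by `DlogLoopRelator_proof`), and products with a relation are relations
(`stub_glueProduct`). [cite: KontsevichZagier2001, §1.2] -/
theorem stub_productInstance :
    ∀ (ϖ₀ : ℝ), IsAlgebraic ℚ ϖ₀ → 0 < ϖ₀ → ϖ₀ < 1 →
      ∀ Φ : KZ.IntegralRep 2, Φ.IsTameCube →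
        (∀ z ∈ KZ.cube 2, Φ.integrand z =
          aeval (Fin.snoc z ϖ₀ : Fin (2 + 1) → ℝ) ((-(C 2 * X 2 * (1 - C 2 * X 0 + X 2 * X 0 ^ 2))) : MvPolynomial (Fin (2 + 1)) ℚ) /
            aeval (Fin.snoc z ϖ₀ : Fin (2 + 1) → ℝ) (((1 - X 2 * X 0) * (1 - X 2 * X 0 ^ 2) * (C 2 - X 2 * X 1)) : MvPolynomial (Fin (2 + 1)) ℚ)) →
        KZ.of Φ ∈ KZ.relations := by
  intro ϖ₀ halg h0 h1 Φ hΦ hΦi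
  -- the two one-variable factors, as rational slices (tame for free)
  have hBf : ∀ y ∈ KZ.cube 1, aeval (Fin.snoc y ϖ₀ : Fin (1 + 1) → ℝ)
      (((1 - X 1 * X 0) * (1 - X 1 * X 0 ^ 2)) : MvPolynomial (Fin (1 + 1)) ℚ) ≠ 0 := by
    intro y hy
    have hy0 : y 0 ∈ Icc (0 : ℝ) 1 := by rw [cube_one_eq] at hy; exact hy
    rw [evalQf, snoc2_0, snoc2_1]
    exact mul_ne_zero (by nlinarith [hy0.1, hy0.2]) (by nlinarith [hy0.1, hy0.2, mul_le_one₀ hy0.2 hy0.1 hy0.2])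
  have hBg : ∀ y ∈ KZ.cube 1, aeval (Fin.snoc y ϖ₀ : Fin (1 + 1) → ℝ)
      ((C 2 - X 1 * X 0) : MvPolynomial (Fin (1 + 1)) ℚ) ≠ 0 := by
    intro y hy
    have hy0 : y 0 ∈ Icc (0 : ℝ) 1 := by rw [cube_one_eq] at hy; exact hy
    rw [evalQg, snoc2_0, snoc2_1]
    nlinarith [hy0.1, hy0.2]
  have glue := stub_glueProduct (M := 2)
    (analyticOnNhd_slice ((-(X 1 * (1 - C 2 * X 0 + X 1 * X 0 ^ 2))) : MvPolynomial (Fin (1 + 1)) ℚ) _ ϖ₀ hBf)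
    (isSemialgebraicFunOn_slice ((-(X 1 * (1 - C 2 * X 0 + X 1 * X 0 ^ 2))) : MvPolynomial (Fin (1 + 1)) ℚ) _ halg hBf)
    (analyticOnNhd_slice ((C 2) : MvPolynomial (Fin (1 + 1)) ℚ) _ ϖ₀ hBg)
    (isSemialgebraicFunOn_slice ((C 2) : MvPolynomial (Fin (1 + 1)) ℚ) _ halg hBg)
    (loop_tame_mem_relations halg h0 h1) (Equiv.refl (Fin 2))
  refine glue.2.2 Φ hΦ fun w hw => ?_
  have ha : 0 ≤ w 0 ∧ w 0 ≤ 1 := KZ.mem_cube.1 hw 0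
  have hb : 0 ≤ w 1 ∧ w 1 ≤ 1 := KZ.mem_cube.1 hw 1
  have hq1 : (1 : ℝ) - ϖ₀ * w 0 ≠ 0 := by nlinarith [ha.1, ha.2]
  have hq2 : (1 : ℝ) - ϖ₀ * w 0 ^ 2 ≠ 0 := by nlinarith [ha.1, ha.2, mul_le_one₀ ha.2 ha.1 ha.2]
  have hq3 : (2 : ℝ) - ϖ₀ * w 1 ≠ 0 := by nlinarith [hb.1, hb.2]
  have hc0 : ((Equiv.refl (Fin 2)) (Fin.castAdd 1 (0 : Fin 1)) : Fin 2) = 0 := rfl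
  have hc1 : ((Equiv.refl (Fin 2)) (Fin.natAdd 1 (0 : Fin 1)) : Fin 2) = 1 := rfl
  rw [hΦi w hw, evalP, evalQ, Gap.snoc3_0, Gap.snoc3_1, Gap.snoc3_2, evalPf, evalQf, evalPg, evalQg]
  simp only [snoc2_0, snoc2_1, hc0, hc1]
  rw [div_mul_div_comm, div_eq_div_iff (mul_ne_zero (mul_ne_zero hq1 hq2) hq3)
    (mul_ne_zero (mul_ne_zero hq1 hq2) hq3)]
  ring

end Summit.KontsevichZagierPeriods.InverseLandau.TateFamilyKernel.Descent
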